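import Mathlib
import HarnessLib
import Literature.Probability.Percolation.MinOpenCut
import Literature.Probability.Percolation.MinOpenCutMenger
import Summits.CriticalPhenomena.PercolationContinuityZ3.Theses.PercBudgetLadder
import Summits.CriticalPhenomena.PercolationContinuityZ3.Theorems.PercBudgetLadderBudgetTightnessDictionary

/-!
# Crux `BudgetTightness` (stmt-CriticalPhenomena-5248): the split in SLAB coordinates —
# `(crossing-cluster COUNT tight) → (mean per-cluster THROUGHPUT bounded) → BudgetTightness`, and its exactness

Landed form (def-free, statements verbatim over tree declarations) of the crux-strategist's kernel-checked
census artefact `Cruxes/BudgetTightness/StrategistSplit_s1.lean` (planner-cstrat s1, `STRATEGY-CENSUS.md`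
§Decomposition, item D1), landed by the line lead c10 as the registered stub `stub_slabSplit` so that the recorded
split is importable next to its annulus twin (`PercBudgetLadderBudgetTightnessAnnulusSplit.lean`, `stub_annulusSplit`).

Notation (inlined everywhere, as in `Lines/Sketch.lean`): `Q(L,h) = Set.Icc ![0,0,0] ![L,L,h]`, bottom
`Set.Icc ![0,0,0] ![L,L,0]`, top `Set.Icc ![0,0,h] ![L,L,h]`, `S(L,h) = minOpenCutIn Q bottom top` (bottom-to-top
min-cut = maximal number of edge-disjoint open vertical crossings), `N(L,h)` = number of open clusters of `Q(L,h)`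
meeting bottom and top, `E = ∫ · ∂P_{p_c(ℤ³)}`.

* T1 (count): `∃ C h₀, ∀ h ≥ h₀, ∀ L ≥ h, h²·E[N(L,h)] ≤ C·L²` — tight density of crossing CLUSTERS for all large
  thicknesses (the `d < 6` hyperscaling count; FALSE for `d ≥ 7` under `η = 0`; its i.o. weakening is necessary for
  the crux by the landed `numCrossingQuadraticIO_of_budgetTightness`).
* T2 (throughput): `∃ K, ∀ H, ∃ h ≥ H, ∀ L ≥ h, h²·E[S(L,h)] ≤ K·(h²·E[N(L,h)]) + K·L²` — bounded mean THROUGHPUT per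
  crossing cluster along a subsequence of thicknesses (necessary for the crux: `perClusterThroughputIO_of_budgetTightness`).
* `stub_slabSplit : T1 → T2 → BudgetTightness` (registered stub; arithmetic + the landed dictionary
  `budgetTightness_of_slabCutQuadraticIO`), `perClusterThroughputIO_of_budgetTightness : BudgetTightness → T2`,
  `budgetTightness_iff_throughput_of_density : T1 → (BudgetTightness ↔ T2)` — under the hyperscaling count the
  crux is EXACTLY the per-cluster throughput statement.
-/

noncomputable section

namespace Summit.CriticalPhenomena.PercolationContinuityZ3.Theorems.BudgetTightness

open MeasureTheory Filter Topology
open Literature.Probability.Percolation Literature.Probability.LatticeModels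
open Summit.CriticalPhenomena.PercolationContinuityZ3.Theses.PercBudgetLadder (BudgetTightness)

/-- **Registered stub `stub_slabSplit` of crux stmt-CriticalPhenomena-5248 — GLUE `T1 → T2 → BudgetTightness`**
(strategist census split D1, slab coordinates; off the composition path of line Sketch). Along T2's thicknesses
`h ≥ max h₀ 1`, `h² E S ≤ K⁺ (h² E N) + K⁺ L² ≤ (K⁺ C⁺ + K⁺) L²` by T1, i.e. `SlabCutQuadraticIO(p_c)`, then the landed
dictionary `budgetTightness_of_slabCutQuadraticIO` (six lids + Markov). (Adapted from
`Cruxes/BudgetTightness/StrategistSplit_s1.lean`.) -/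
theorem stub_slabSplit : (∃ C : ℝ, ∃ h₀ : ℕ, ∀ h : ℕ, h₀ ≤ h → ∀ L : ℕ, h ≤ L → (h : ℝ) ^ 2 * ∫ ω, (({c : ((openGraph ω).induce (Set.Icc (![0, 0, 0] : Site 3) ![(L : ℤ), (L : ℤ), (h : ℤ)])).ConnectedComponent | (∃ x : ↥(Set.Icc (![0, 0, 0] : Site 3) ![(L : ℤ), (L : ℤ), (h : ℤ)]), (x : Site 3) ∈ Set.Icc (![0, 0, 0] : Site 3) ![(L : ℤ), (L : ℤ), 0] ∧ ((openGraph ω).induce (Set.Icc (![0, 0, 0] : Site 3) ![(L : ℤ), (L : ℤ), (h : ℤ)])).connectedComponentMk x = c) ∧ ∃ y : ↥(Set.Icc (![0, 0, 0] : Site 3) ![(L : ℤ), (L : ℤ), (h : ℤ)]), (y : Site 3) ∈ Set.Icc (![0, 0, (h : ℤ)] : Site 3) ![(L : ℤ), (L : ℤ), (h : ℤ)] ∧ ((openGraph ω).induce (Set.Icc (![0, 0, 0] : Site 3) ![(L : ℤ), (L : ℤ), (h : ℤ)])).connectedComponentMk y = c}.encard).toNat : ℝ) ∂(bondPercolation (zdGraph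 3) (criticalProbI 3)) ≤ C * (L : ℝ) ^ 2) → (∃ K : ℝ, ∀ H : ℕ, ∃ h : ℕ, H ≤ h ∧ ∀ L : ℕ, h ≤ L → (h : ℝ) ^ 2 * ∫ ω, ((minOpenCutIn (Set.Icc (![0, 0, 0] : Site 3) ![(L : ℤ), (L : ℤ), (h : ℤ)]) (Set.Icc (![0, 0, 0] : Site 3) ![(L : ℤ), (L : ℤ), 0]) (Set.Icc (![0, 0, (h : ℤ)] : Site 3) ![(L : ℤ), (L : ℤ), (h : ℤ)]) ω).toNat : ℝ) ∂(bondPercolation (zdGraph 3) (criticalProbI 3)) ≤ K * ((h : ℝ) ^ 2 * ∫ ω, (({c : ((openGraph ω).induce (Set.Icc (![0, 0, 0] : Site 3) ![(L : ℤ), (L : ℤ), (h : ℤ)])).ConnectedComponent | (∃ x : ↥(Set.Icc (![0, 0, 0] : Site 3) ![(L : ℤ), (L : ℤ), (h : ℤ)]), (x : Site 3) ∈ Set.Icc (![0, 0, 0] : Site 3) ![(L : ℤ), (L : ℤ), 0] ∧ ((openGraph ω).induce (Set.Icc (![0, 0, 0] : Site 3) ![(L : ℤ), (L : ℤ), (h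 : ℤ)])).connectedComponentMk x = c) ∧ ∃ y : ↥(Set.Icc (![0, 0, 0] : Site 3) ![(L : ℤ), (L : ℤ), (h : ℤ)]), (y : Site 3) ∈ Set.Icc (![0, 0, (h : ℤ)] : Site 3) ![(L : ℤ), (L : ℤ), (h : ℤ)] ∧ ((openGraph ω).induce (Set.Icc (![0, 0, 0] : Site 3) ![(L : ℤ), (L : ℤ), (h : ℤ)])).connectedComponentMk y = c}.encard).toNat : ℝ) ∂(bondPercolation (zdGraph 3) (criticalProbI 3))) + K * (L : ℝ) ^ 2) → Summit.CriticalPhenomena.PercolationContinuityZ3.Theses.PercBudgetLadder.BudgetTightness := by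
  rintro ⟨C, h₀, hC⟩ ⟨K, hK⟩
  refine budgetTightness_of_slabCutQuadraticIO ⟨max K 0 * max C 0 + max K 0, fun H => ?_⟩
  obtain ⟨h, hHh, hL⟩ := hK (max H (max h₀ 1))
  have hh₀ : h₀ ≤ h := le_trans (le_trans (le_max_left _ _) (le_max_right _ _)) hHh
  refine ⟨h, le_trans (le_max_left _ _) hHh, fun L hLh => ?_⟩
  have hT2 := hL L hLh
  have hT1 := hC h hh₀ L hLh
  -- abbreviate the two integrals
  set IS : ℝ := ∫ ω, ((minOpenCutIn
        (Set.Icc (![0, 0, 0] : Site 3) ![(L : ℤ), (L : ℤ), (h : ℤ)])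
        (Set.Icc (![0, 0, 0] : Site 3) ![(L : ℤ), (L : ℤ), 0])
        (Set.Icc (![0, 0, (h : ℤ)] : Site 3) ![(L : ℤ), (L : ℤ), (h : ℤ)])
        ω).toNat : ℝ) ∂(bondPercolation (zdGraph 3) (criticalProbI 3)) with hIS
  set IN : ℝ := ∫ ω, (({c : ((openGraph ω).induce
        (Set.Icc (![0, 0, 0] : Site 3) ![(L : ℤ), (L : ℤ), (h : ℤ)])).ConnectedComponent |
      (∃ x : ↥(Set.Icc (![0, 0, 0] : Site 3) ![(L : ℤ), (L : ℤ), (h : ℤ)]),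
        (x : Site 3) ∈ Set.Icc (![0, 0, 0] : Site 3) ![(L : ℤ), (L : ℤ), 0] ∧
        ((openGraph ω).induce (Set.Icc (![0, 0, 0] : Site 3) ![(L : ℤ), (L : ℤ), (h : ℤ)])).connectedComponentMk x = c) ∧
      ∃ y : ↥(Set.Icc (![0, 0, 0] : Site 3) ![(L : ℤ), (L : ℤ), (h : ℤ)]),
        (y : Site 3) ∈ Set.Icc (![0, 0, (h : ℤ)] : Site 3) ![(L : ℤ), (L : ℤ), (h : ℤ)] ∧
        ((openGraph ω).induce (Set.Icc (![0, 0, 0] : Site 3) ![(L : ℤ), (L : ℤ), (h : ℤ)])).connectedComponentMk y = c}.encard).toNat : ℝ)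
      ∂(bondPercolation (zdGraph 3) (criticalProbI 3)) with hIN
  have hINnn : 0 ≤ IN := integral_nonneg fun ω => Nat.cast_nonneg _
  have hX : 0 ≤ (h : ℝ) ^ 2 * IN := mul_nonneg (by positivity) hINnn
  have hL2 : 0 ≤ (L : ℝ) ^ 2 := by positivity
  -- replace K by K⁺ = max K 0 and C by C⁺ = max C 0
  have step1 : (h : ℝ) ^ 2 * IS ≤ max K 0 * ((h : ℝ) ^ 2 * IN) + max K 0 * (L : ℝ) ^ 2 :=
    hT2.trans (add_le_add (mul_le_mul_of_nonneg_right (le_max_left _ _) hX)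
      (mul_le_mul_of_nonneg_right (le_max_left _ _) hL2))
  have step2 : (h : ℝ) ^ 2 * IN ≤ max C 0 * (L : ℝ) ^ 2 :=
    hT1.trans (mul_le_mul_of_nonneg_right (le_max_left _ _) hL2)
  have hK0 : 0 ≤ max K 0 := le_max_right _ _
  calc (h : ℝ) ^ 2 * IS ≤ max K 0 * ((h : ℝ) ^ 2 * IN) + max K 0 * (L : ℝ) ^ 2 := step1
    _ ≤ max K 0 * (max C 0 * (L : ℝ) ^ 2) + max K 0 * (L : ℝ) ^ 2 := by
        gcongr
    _ = (max K 0 * max C 0 + max K 0) * (L : ℝ) ^ 2 := by ring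

/-- **T2 is NECESSARY for the crux** (so the split loses nothing on the throughput side): from the landed
converse dictionary `slabCutQuadraticIO_of_budgetTightness` (`h² E S ≤ C L²` i.o.) with `K = C⁺`, dropping the
non-negative cluster-count term. (Adapted from `Cruxes/BudgetTightness/StrategistSplit_s1.lean`.) -/
theorem perClusterThroughputIO_of_budgetTightness (hBT : BudgetTightness) :
    ∃ K : ℝ, ∀ H : ℕ, ∃ h : ℕ, H ≤ h ∧ ∀ L : ℕ, h ≤ L →
      (h : ℝ) ^ 2 * ∫ ω, ((minOpenCutIn
        (Set.Icc (![0, 0, 0] : Site 3) ![(L : ℤ), (L : ℤ), (h : ℤ)])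
        (Set.Icc (![0, 0, 0] : Site 3) ![(L : ℤ), (L : ℤ), 0])
        (Set.Icc (![0, 0, (h : ℤ)] : Site 3) ![(L : ℤ), (L : ℤ), (h : ℤ)])
        ω).toNat : ℝ) ∂(bondPercolation (zdGraph 3) (criticalProbI 3)) ≤
      K * ((h : ℝ) ^ 2 * ∫ ω, (({c : ((openGraph ω).induce
        (Set.Icc (![0, 0, 0] : Site 3) ![(L : ℤ), (L : ℤ), (h : ℤ)])).ConnectedComponent |
      (∃ x : ↥(Set.Icc (![0, 0, 0] : Site 3) ![(L : ℤ), (L : ℤ), (h : ℤ)]),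
        (x : Site 3) ∈ Set.Icc (![0, 0, 0] : Site 3) ![(L : ℤ), (L : ℤ), 0] ∧
        ((openGraph ω).induce (Set.Icc (![0, 0, 0] : Site 3) ![(L : ℤ), (L : ℤ), (h : ℤ)])).connectedComponentMk x = c) ∧
      ∃ y : ↥(Set.Icc (![0, 0, 0] : Site 3) ![(L : ℤ), (L : ℤ), (h : ℤ)]),
        (y : Site 3) ∈ Set.Icc (![0, 0, (h : ℤ)] : Site 3) ![(L : ℤ), (L : ℤ), (h : ℤ)] ∧
        ((openGraph ω).induce (Set.Icc (![0, 0, 0] : Site 3) ![(L : ℤ), (L : ℤ), (h : ℤ)])).connectedComponentMk y = c}.encard).toNat : ℝ)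
      ∂(bondPercolation (zdGraph 3) (criticalProbI 3))) + K * (L : ℝ) ^ 2 := by
  obtain ⟨C, hcore⟩ := slabCutQuadraticIO_of_budgetTightness hBT
  refine ⟨max C 0, fun H => ?_⟩
  obtain ⟨h, hHh, hL⟩ := hcore H
  refine ⟨h, hHh, fun L hLh => ?_⟩
  have h1 := hL L hLh
  have hL2 : 0 ≤ (L : ℝ) ^ 2 := by positivity
  have hIN : 0 ≤ (h : ℝ) ^ 2 * ∫ ω, (({c : ((openGraph ω).induce
        (Set.Icc (![0, 0, 0] : Site 3) ![(L : ℤ), (L : ℤ), (h : ℤ)])).ConnectedComponent |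
      (∃ x : ↥(Set.Icc (![0, 0, 0] : Site 3) ![(L : ℤ), (L : ℤ), (h : ℤ)]),
        (x : Site 3) ∈ Set.Icc (![0, 0, 0] : Site 3) ![(L : ℤ), (L : ℤ), 0] ∧
        ((openGraph ω).induce (Set.Icc (![0, 0, 0] : Site 3) ![(L : ℤ), (L : ℤ), (h : ℤ)])).connectedComponentMk x = c) ∧
      ∃ y : ↥(Set.Icc (![0, 0, 0] : Site 3) ![(L : ℤ), (L : ℤ), (h : ℤ)]),
        (y : Site 3) ∈ Set.Icc (![0, 0, (h : ℤ)] : Site 3) ![(L : ℤ), (L : ℤ), (h : ℤ)] ∧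
        ((openGraph ω).induce (Set.Icc (![0, 0, 0] : Site 3) ![(L : ℤ), (L : ℤ), (h : ℤ)])).connectedComponentMk y = c}.encard).toNat : ℝ)
      ∂(bondPercolation (zdGraph 3) (criticalProbI 3)) :=
    mul_nonneg (by positivity) (integral_nonneg fun ω => Nat.cast_nonneg _)
  calc _ ≤ C * (L : ℝ) ^ 2 := h1
    _ ≤ max C 0 * (L : ℝ) ^ 2 := mul_le_mul_of_nonneg_right (le_max_left _ _) hL2
    _ ≤ max C 0 * _ + max C 0 * (L : ℝ) ^ 2 :=
        le_add_of_nonneg_left (mul_nonneg (le_max_right _ _) hIN)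

/-- **Under T1 the crux is EXACTLY T2** (`T1 → (BudgetTightness ↔ T2)`): given the hyperscaling count of crossing
clusters of critical slabs, the whole residual difficulty of `BudgetTightness` is the boundedness of the mean
per-cluster throughput along a subsequence of thicknesses. -/
theorem budgetTightness_iff_throughput_of_density
    (h1 : (∃ C : ℝ, ∃ h₀ : ℕ, ∀ h : ℕ, h₀ ≤ h → ∀ L : ℕ, h ≤ L → (h : ℝ) ^ 2 * ∫ ω, (({c : ((openGraph ω).induce (Set.Icc (![0, 0, 0] : Site 3) ![(L : ℤ), (L : ℤ), (h : ℤ)])).ConnectedComponent | (∃ x : ↥(Set.Icc (![0, 0, 0] : Site 3) ![(L : ℤ), (L : ℤ), (h : ℤ)]), (x : Site 3) ∈ Set.Icc (![0, 0, 0] : Site 3) ![(L : ℤ), (L : ℤ), 0] ∧ ((openGraph ω).induce (Set.Icc (![0, 0, 0] : Site 3) ![(L : ℤ), (L : ℤ), (h : ℤ)])).connectedComponentMk x = c) ∧ ∃ y : ↥(Set.Icc (![0, 0, 0] : Site 3) ![(L : ℤ), (L : ℤ), (h : ℤ)]), (y : Site 3) ∈ Set.Icc (![0, 0, (h : ℤ)]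 : Site 3) ![(L : ℤ), (L : ℤ), (h : ℤ)] ∧ ((openGraph ω).induce (Set.Icc (![0, 0, 0] : Site 3) ![(L : ℤ), (L : ℤ), (h : ℤ)])).connectedComponentMk y = c}.encard).toNat : ℝ) ∂(bondPercolation (zdGraph 3) (criticalProbI 3)) ≤ C * (L : ℝ) ^ 2)) :
    BudgetTightness ↔
      ∃ K : ℝ, ∀ H : ℕ, ∃ h : ℕ, H ≤ h ∧ ∀ L : ℕ, h ≤ L →
        (h : ℝ) ^ 2 * ∫ ω, ((minOpenCutIn
        (Set.Icc (![0, 0, 0] : Site 3) ![(L : ℤ), (L : ℤ), (h : ℤ)])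
        (Set.Icc (![0, 0, 0] : Site 3) ![(L : ℤ), (L : ℤ), 0])
        (Set.Icc (![0, 0, (h : ℤ)] : Site 3) ![(L : ℤ), (L : ℤ), (h : ℤ)])
        ω).toNat : ℝ) ∂(bondPercolation (zdGraph 3) (criticalProbI 3)) ≤
        K * ((h : ℝ) ^ 2 * ∫ ω, (({c : ((openGraph ω).induce
        (Set.Icc (![0, 0, 0] : Site 3) ![(L : ℤ), (L : ℤ), (h : ℤ)])).ConnectedComponent |
      (∃ x : ↥(Set.Icc (![0, 0, 0] : Site 3) ![(L : ℤ), (L : ℤ), (h : ℤ)]),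
        (x : Site 3) ∈ Set.Icc (![0, 0, 0] : Site 3) ![(L : ℤ), (L : ℤ), 0] ∧
        ((openGraph ω).induce (Set.Icc (![0, 0, 0] : Site 3) ![(L : ℤ), (L : ℤ), (h : ℤ)])).connectedComponentMk x = c) ∧
      ∃ y : ↥(Set.Icc (![0, 0, 0] : Site 3) ![(L : ℤ), (L : ℤ), (h : ℤ)]),
        (y : Site 3) ∈ Set.Icc (![0, 0, (h : ℤ)] : Site 3) ![(L : ℤ), (L : ℤ), (h : ℤ)] ∧
        ((openGraph ω).induce (Set.Icc (![0, 0, 0] : Site 3) ![(L : ℤ), (L : ℤ), (h : ℤ)])).connectedComponentMk y = c}.encard).toNat : ℝ)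
      ∂(bondPercolation (zdGraph 3) (criticalProbI 3))) + K * (L : ℝ) ^ 2 :=
  ⟨perClusterThroughputIO_of_budgetTightness, stub_slabSplit h1⟩

end Summit.CriticalPhenomena.PercolationContinuityZ3.Theorems.BudgetTightness

end
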